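import Summits.BirchSwinnertonDyer.BirchSwinnertonDyer.Theses.EisensteinDepletionAtTwo
import Summits.BirchSwinnertonDyer.BirchSwinnertonDyer.Theorems.EisensteinDepletionAtTwoStarEulerOrder
import Literature.NumberTheory.EllipticCurves.KubotaLeopoldtTwoNumerator
import Literature.NumberTheory.EllipticCurves.MatsunoLocalTermAtTwoReductionTypeProofs
import Literature.NumberTheory.EllipticCurves.NonEisensteinPrimeOfSurjective
import HarnessLib

/-!
# Route `EisensteinDepletionAtTwo`, crux E1M `DepletedLambdaLawAtTwoMod` (item stmt-BirchSwinnertonDyer-20341),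
# line `star` — the research stub (★) `StarCongruenceAtTwo` REDUCES to its depletion-free core (★-core)

Cell `bsd-rank2` (HOME run/shared/lean/pub/bsd-rank2/), seat `bsd-rank2-star-p1` (lead of line `star`; skeleton
`Summits/…/Cruxes/DepletedLambdaLawAtTwoMod/Lines/star.lean`). THEOREMS ONLY — no definition, no named fact, no `sorry`.
HONEST FRAMING: pure `Λ`-bookkeeping. The research content of (★) is untouched and stays OPEN as (★-core); this file only
removes the depletion set `S` and Greenberg–Vatsal's Euler factors `𝒫_ℓ` from it. BSD is not proved by any of this;
nothing here reads an analytic rank (PARTITION D-0054: none — r_an ≥ 2 axis S0, door T-r3₂).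

**Content.** `Λ = ℤ₂⟦T⟧`, `red : Λ → 𝔽₂⟦T⟧` the reduction (`X1.MuLambda.red`), `pfree` the `2`-free part,
`γ_ℓ = (1+T)^{f_ℓ} = frobeniusSeries 2 ℓ`, `r_ℓ = red(γ_ℓ − 1)`, `𝒫_ℓ = eulerFactorElement W 2 v_ℓ`, `N = N_W`.
* §1 — on the reducible-`E[2]` habitat (a rational point of order `2`) the reduction of `𝒫_ℓ` at an odd prime `ℓ` is
  EXACTLY `r_ℓ²` (good `ℓ`: `a_ℓ` even, `P̃_ℓ = 1 + X² = (X − 1)²`), `r_ℓ` (multiplicative: `P̃_ℓ = 1 ∓ X = X − 1`), `1`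
  (additive: `P_ℓ = 1`) — as power series, not only up to `T`-order (the orders are the tree's
  `TwoAdicTwistConverse.order_map_toZMod_eulerFactorElement_two`); `ℓ̃⁻¹ = 1` in `𝔽₂`.
* §2 — hence `red(∏_{ℓ∈S}[ℓ≠2]𝒫_ℓ) = ∏_{ℓ∈S∖2} r_ℓ^{d_ℓ}` with `d_ℓ = 2, 1, 0` for `ord_ℓ(N) = 0, = 1, ≥ 2`, and
  `pfree(g·h) = pfree(g)·h` when `red h ≠ 0`.
* §3 — **(★-core) ⇒ (★)** (`starCongruence_of_starCore`), where (★-core) is (★) with `S` and the `𝒫_ℓ` removed: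
  `T²·red(pfree L₀) = red((1+T)^e)·red(pfree G₀)·red(pfree G₀^ι)·∏_{ℓ∣N} r_ℓ^{m_ℓ}`, `m_ℓ = 1` if `ord_ℓ(N) = 1` else `2`
  (`m_ℓ + d_ℓ = 2` at the bad primes, `d_ℓ = 2` at the good odd ones, `N` odd, so multiplying (★-core) by
  `∏_{S∖2} r_ℓ^{d_ℓ}` gives (★)'s right-hand side `∏_{S∖2} r_ℓ²`). The lead's skeleton v1.3 registers `stub_starCore`
  (signature `StarCoreAtTwo` = the hypothesis of `starCongruence_of_starCore` with the line's local names) in place of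
  `stub_starCongruence`, which becomes a one-line consequence.

References: R. Greenberg, V. Vatsal, Invent. Math. 142 (2000), §1 display (9), §2 Prop. (2.4), §3 Thm. (3.12)
[GreenbergVatsal2000]; K. Matsuno, Int. J. Number Theory 4 (2008), Lemma 2.4, Prop. 6.2 [Matsuno2008]; J. Silverman,
*Advanced Topics*, IV.10.2 [Silverman1994]; L. Washington, GTM 83, §7.1 [Washington1997].
-/

set_option linter.dupNamespace false
set_option autoImplicit false

noncomputable section

open scoped Classical

open Polynomial NumberField IsDedekindDomain WeierstrassCurve Rat.HeightOneSpectrum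
  Literature.NumberTheory.EllipticCurves Literature.NumberTheory.EllipticCurves.GreenbergVatsal2000
  Literature.NumberTheory.EllipticCurves.Greenberg1999 Literature.NumberTheory.EllipticCurves.ModularForms
  Summit.BirchSwinnertonDyer.Rank1Residual.X1.MuLambda
  Summit.BirchSwinnertonDyer.Rank1Residual.X2.EulerFactorInvariants
  Summit.BirchSwinnertonDyer.BirchSwinnertonDyer.Theorems.TwoAdicTwistConverse

namespace Summit.BirchSwinnertonDyer.BirchSwinnertonDyer.Theorems.DepletionAtTwo

/-! ## §1. Exact reductions of `𝒫_ℓ` modulo `2` -/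

section ExactReduction

/-- `2 = 0` in `𝔽₂⟦T⟧` (the class of `2` in `𝔽₂ = ℤ₂/𝔪` vanishes — tree `X11b.residue_two_padicInt_two`, restated
inline to keep this file's imports inside the cell). [folklore] -/
theorem two_eq_zero_powerSeries_residueField_two :
    (2 : PowerSeries (IsLocalRing.ResidueField ℤ_[2])) = 0 := by
  have h2 : IsLocalRing.residue ℤ_[2] 2 = 0 := by
    rw [IsLocalRing.residue_eq_zero_iff, PadicInt.maximalIdeal_eq_span_p, Ideal.mem_span_singleton]
    exact ⟨1, by norm_num⟩
  have h : (PowerSeries.C (IsLocalRing.residue ℤ_[2] 2) : PowerSeries (IsLocalRing.ResidueField ℤ_[2])) = 0 := by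
    rw [h2, map_zero]
  rwa [map_ofNat, map_ofNat] at h

/-- An even integer is `0` in `𝔽₂⟦T⟧`. [folklore] -/
theorem intCast_powerSeries_eq_zero_of_even {a : ℤ} (ha : Even a) :
    (a : PowerSeries (IsLocalRing.ResidueField ℤ_[2])) = 0 := by
  obtain ⟨k, rfl⟩ := ha
  rw [← two_mul, Int.cast_mul, Int.cast_ofNat, two_eq_zero_powerSeries_residueField_two, zero_mul]

/-- An odd natural number is `1` in `𝔽₂⟦T⟧`. [folklore] -/
theorem natCast_powerSeries_eq_one_of_coprime {ℓ : ℕ} (hℓ : (2 : ℕ).Coprime ℓ) :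
    ((ℓ : ℤ) : PowerSeries (IsLocalRing.ResidueField ℤ_[2])) = 1 := by
  obtain ⟨k, hk⟩ := Nat.coprime_two_left.mp hℓ
  rw [hk, Int.cast_natCast, Nat.cast_add, Nat.cast_mul, Nat.cast_ofNat,
    two_eq_zero_powerSeries_residueField_two, zero_mul, zero_add, Nat.cast_one]

/-- The residue of `ℓ⁻¹ ∈ ℤ₂` (`PadicInt.inv`) in `𝔽₂` is `1` for odd `ℓ`. [folklore] -/
theorem residue_inv_natCast_eq_one_of_coprime {ℓ : ℕ} (hℓ : (2 : ℕ).Coprime ℓ) :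
    IsLocalRing.residue ℤ_[2] ((ℓ : ℤ_[2]).inv) = 1 := by
  have hnorm : ‖(ℓ : ℤ_[2])‖ = 1 := PadicInt.norm_natCast_eq_one_iff.mpr hℓ
  have hmul : IsLocalRing.residue ℤ_[2] (ℓ : ℤ_[2]) * IsLocalRing.residue ℤ_[2] ((ℓ : ℤ_[2]).inv) = 1 := by
    rw [← map_mul, PadicInt.mul_inv hnorm, map_one]
  have hℓ1 : IsLocalRing.residue ℤ_[2] (ℓ : ℤ_[2]) = 1 := by
    obtain ⟨k, hk⟩ := Nat.coprime_two_left.mp hℓ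
    rw [← sub_eq_zero, ← map_one (IsLocalRing.residue ℤ_[2]), ← map_sub, IsLocalRing.residue_eq_zero_iff,
      PadicInt.maximalIdeal_eq_span_p, Ideal.mem_span_singleton]
    exact ⟨k, by rw [hk]; push_cast; ring⟩
  rwa [hℓ1, one_mul] at hmul

/-- `red(g − 1) = red g − 1` (`red` is a ring map). [folklore] -/
theorem red_sub_one {p : ℕ} [Fact p.Prime] (g : IwasawaAlgebra p) : red (g - 1) = red g - 1 := by
  unfold red
  rw [map_sub, map_one]

/-- `red(g · h) = red g · red h` (`red` is a ring map). [folklore] -/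
theorem red_mul' {p : ℕ} [Fact p.Prime] (g h : IwasawaAlgebra p) : red (g * h) = red g * red h := by
  unfold red
  rw [map_mul]

variable (W : WeierstrassCurve ℚ) (v : HeightOneSpectrum (𝓞 ℚ))

/-- `red(𝒫_ℓ) = P_ℓ(red γ_ℓ)` evaluated through `ℤ → 𝔽₂⟦T⟧`, for odd `ℓ` (`ℓ̃⁻¹ = 1` in `𝔽₂`).
[cite: GreenbergVatsal2000, §2 Prop. (2.4) (p. 22)] -/
theorem red_eulerFactorElement_two_eq_eval₂ (hℓ : natGenerator v ≠ 2) :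
    red (eulerFactorElement W 2 v) =
      (W.localPolynomialAt v).eval₂ (Int.castRingHom _) (red (frobeniusSeries 2 (natGenerator v))) := by
  obtain ⟨hcop, -⟩ := coprime_natGenerator v (p := 2) hℓ
  rw [eulerFactorElement_eq, Polynomial.aeval_def, red, Polynomial.hom_eval₂, map_mul, PowerSeries.map_C,
    residue_inv_natCast_eq_one_of_coprime hcop, map_one, one_mul, frobeniusSeries_eq]
  congr 1
  exact RingHom.ext_int _ _

/-- **Good odd `ℓ` with `a_ℓ` even: `red(𝒫_ℓ) = red(γ_ℓ − 1)²`** (`P̃_ℓ = 1 + X² = (X − 1)²` in `𝔽₂[X]`, `ℓ̃⁻¹ = 1`).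
[cite: GreenbergVatsal2000, §2 Prop. (2.4) (p. 22)] -/
theorem red_eulerFactorElement_two_of_good_of_even (hv : W.HasGoodReductionAt v) (hℓ : natGenerator v ≠ 2)
    (ha : Even (W.frobeniusTraceAt v)) :
    red (eulerFactorElement W 2 v) = red (frobeniusSeries 2 (natGenerator v) - 1) ^ 2 := by
  obtain ⟨hcop, -⟩ := coprime_natGenerator v (p := 2) hℓ
  have hq : ((Nat.card (IsLocalRing.ResidueField (v.adicCompletionIntegers ℚ)) : ℤ) :
      PowerSeries (IsLocalRing.ResidueField ℤ_[2])) = 1 := by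
    rw [natCard_residueField_adicCompletionIntegers]
    have : (primesEquiv v : ℕ) = natGenerator v := rfl
    rw [this]
    exact natCast_powerSeries_eq_one_of_coprime hcop
  rw [red_eulerFactorElement_two_eq_eval₂ W v hℓ, localPolynomialAt_of_hasGoodReductionAt hv,
    Polynomial.eval₂_add, Polynomial.eval₂_sub, Polynomial.eval₂_one, Polynomial.eval₂_mul, Polynomial.eval₂_C,
    Polynomial.eval₂_X, Polynomial.eval₂_mul, Polynomial.eval₂_C, Polynomial.eval₂_pow, Polynomial.eval₂_X,
    eq_intCast, eq_intCast, intCast_powerSeries_eq_zero_of_even ha, hq, red_sub_one]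
  linear_combination (red (frobeniusSeries 2 (natGenerator v))) * two_eq_zero_powerSeries_residueField_two

/-- **Multiplicative odd `ℓ`: `red(𝒫_ℓ) = red(γ_ℓ − 1)`** (`P̃_ℓ = 1 ∓ X = X − 1` in `𝔽₂[X]`).
[cite: GreenbergVatsal2000, §2 Prop. (2.4) (p. 22)] -/
theorem red_eulerFactorElement_two_of_multiplicative (hv : W.HasMultiplicativeReductionAt v)
    (hℓ : natGenerator v ≠ 2) :
    red (eulerFactorElement W 2 v) = red (frobeniusSeries 2 (natGenerator v) - 1) := by
  rw [red_eulerFactorElement_two_eq_eval₂ W v hℓ, red_sub_one]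
  by_cases hs : W.HasSplitMultiplicativeReductionAt v
  · rw [localPolynomialAt_of_hasSplitMultiplicativeReductionAt hs, Polynomial.eval₂_sub, Polynomial.eval₂_one,
      Polynomial.eval₂_X]
    linear_combination (1 - red (frobeniusSeries 2 (natGenerator v))) * two_eq_zero_powerSeries_residueField_two
  · rw [localPolynomialAt_of_hasMultiplicativeReductionAt_of_not_hasSplitMultiplicativeReductionAt hv hs,
      Polynomial.eval₂_add, Polynomial.eval₂_one, Polynomial.eval₂_X]
    linear_combination two_eq_zero_powerSeries_residueField_two

/-- **Additive `ℓ`: `red(𝒫_ℓ) = 1`** (`P_ℓ = 1`). [cite: GreenbergVatsal2000, §2 Prop. (2.4) (p. 22)] -/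
theorem red_eulerFactorElement_two_of_additive (hv : W.HasAdditiveReductionAt v) (hℓ : natGenerator v ≠ 2) :
    red (eulerFactorElement W 2 v) = 1 := by
  rw [red_eulerFactorElement_two_eq_eval₂ W v hℓ, localPolynomialAt_of_hasAdditiveReductionAt hv,
    Polynomial.eval₂_one]

end ExactReduction

/-! ## §2. The depleting product `∏_{ℓ∈S} 𝒫_ℓ` modulo `2` on the reducible-`E[2]` habitat -/

section Product

variable (W : WeierstrassCurve ℚ) [W.IsElliptic] [W.IsGloballyMinimal]

/-- **`red(𝒫_ℓ) = r_ℓ^{d_ℓ}` at an odd prime `ℓ` of a curve with a rational point of order `2`**, with the exponent READ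
OFF THE CONDUCTOR: `d_ℓ = 2` if `ord_ℓ(N) = 0` (good, `a_ℓ` even), `1` if `ord_ℓ(N) = 1` (multiplicative), `0` if
`ord_ℓ(N) ≥ 2` (additive); and `𝒫_ℓ ≠ 0`. (`r_ℓ = red(γ_ℓ − 1)`, `v_ℓ = primesEquiv.symm ℓ`; dictionary
`factorization_conductorNorm_natGenerator`, Silverman ATAEC IV.10.2.)
[cite: GreenbergVatsal2000, §2 Prop. (2.4) (p. 22)] [cite: Silverman1994, IV.10.2] -/
theorem red_eulerFactorElement_two_of_hasRationalTwoTorsionX {x : ℚ} (hx : HasRationalTwoTorsionX W x) {ℓ : ℕ}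
    (hℓ : ℓ.Prime) (h2 : ℓ ≠ 2) :
    eulerFactorElement W 2 ((primesEquiv (R := 𝓞 ℚ)).symm ⟨ℓ, hℓ⟩) ≠ 0 ∧
      red (eulerFactorElement W 2 ((primesEquiv (R := 𝓞 ℚ)).symm ⟨ℓ, hℓ⟩)) =
        red (frobeniusSeries 2 ℓ - 1) ^
          (if (W.conductorNorm ℤ).factorization ℓ = 0 then 2
            else if (W.conductorNorm ℤ).factorization ℓ = 1 then 1 else 0) := by
  set v : HeightOneSpectrum (𝓞 ℚ) := (primesEquiv (R := 𝓞 ℚ)).symm ⟨ℓ, hℓ⟩ with hv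
  have hgen : natGenerator v = ℓ := congrArg Subtype.val ((primesEquiv (R := 𝓞 ℚ)).apply_symm_apply ⟨ℓ, hℓ⟩)
  have hv2 : natGenerator v ≠ 2 := by rw [hgen]; exact h2
  have hfac : (W.conductorNorm ℤ).factorization ℓ = W.conductorExponent v := by
    rw [← hgen]; exact factorization_conductorNorm_natGenerator W v
  refine ⟨eulerFactorElement_two_ne_zero W v hv2, ?_⟩
  rw [hfac]
  rcases Nat.lt_or_ge (W.conductorExponent v) 2 with hlt | hge
  · rcases Nat.lt_or_ge (W.conductorExponent v) 1 with h0 | h1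
    · have hf : W.conductorExponent v = 0 := by omega
      have hgood : W.HasGoodReductionAt v := (conductorExponent_eq_zero_iff_holds v W).mp hf
      rw [if_pos hf, red_eulerFactorElement_two_of_good_of_even W v hgood hv2
        (even_frobeniusTraceAt_of_hasRationalTwoTorsionX W v hgood hv2 hx), hgen]
    · have hf : W.conductorExponent v = 1 := by omega
      have hmult : W.HasMultiplicativeReductionAt v := (conductorExponent_eq_one_iff_holds v W).mp hf
      rw [if_neg (by omega), if_pos hf, pow_one, red_eulerFactorElement_two_of_multiplicative W v hmult hv2, hgen]
  · have hadd : W.HasAdditiveReductionAt v := (two_le_conductorExponent_iff_holds v W).mp hge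
    rw [if_neg (by omega), if_neg (by omega), pow_zero, red_eulerFactorElement_two_of_additive W v hadd hv2]

/-- **The depleting product modulo `2`**: for a finite set `S` of primes and a curve with a rational point of order `2`,
`∏_{ℓ∈S} [ℓ ≠ 2] 𝒫_ℓ ≠ 0` and `red(∏_{ℓ∈S} [ℓ ≠ 2] 𝒫_ℓ) = ∏_{ℓ∈S, ℓ≠2} r_ℓ^{d_ℓ}` (`d_ℓ` as in
`red_eulerFactorElement_two_of_hasRationalTwoTorsionX`). [cite: GreenbergVatsal2000, §1 p. 9 (display (9)), §2 Prop. (2.4)] -/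
theorem red_prod_depletingFactor_two_of_hasRationalTwoTorsionX {x : ℚ} (hx : HasRationalTwoTorsionX W x)
    (S : Finset ℕ) (hS : ∀ ℓ ∈ S, ℓ.Prime) :
    (∏ ℓ ∈ S, (if h : Nat.Prime ℓ ∧ ℓ ≠ 2 then
        eulerFactorElement W 2 ((primesEquiv (R := 𝓞 ℚ)).symm ⟨ℓ, h.1⟩) else 1)) ≠ 0 ∧
    red (∏ ℓ ∈ S, (if h : Nat.Prime ℓ ∧ ℓ ≠ 2 then
        eulerFactorElement W 2 ((primesEquiv (R := 𝓞 ℚ)).symm ⟨ℓ, h.1⟩) else 1)) =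
      ∏ ℓ ∈ S.filter (· ≠ 2), red (frobeniusSeries 2 ℓ - 1) ^
        (if (W.conductorNorm ℤ).factorization ℓ = 0 then 2
          else if (W.conductorNorm ℤ).factorization ℓ = 1 then 1 else 0) := by
  induction S using Finset.induction_on with
  | empty =>
    refine ⟨by rw [Finset.prod_empty]; exact one_ne_zero, ?_⟩
    rw [Finset.prod_empty, Finset.filter_empty, Finset.prod_empty]
    unfold red
    rw [map_one]
  | insert a S ha ih =>
    obtain ⟨ihne, ihred⟩ := ih (fun ℓ hℓ ↦ hS ℓ (Finset.mem_insert_of_mem hℓ))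
    have haP : a.Prime := hS a (Finset.mem_insert_self a S)
    rw [Finset.prod_insert ha, Finset.filter_insert]
    by_cases h2 : a ≠ 2
    · obtain ⟨hne, hred⟩ := red_eulerFactorElement_two_of_hasRationalTwoTorsionX W hx haP h2
      rw [dif_pos ⟨haP, h2⟩, if_pos h2, Finset.prod_insert (fun h ↦ ha (Finset.mem_filter.mp h).1)]
      exact ⟨mul_ne_zero hne ihne, by rw [red_mul', hred, ihred]⟩
    · rw [dif_neg (fun h ↦ h2 h.2), if_neg h2, one_mul]
      exact ⟨ihne, ihred⟩

/-- `pfree (g · h) = pfree g · h` when `h` has unit content (`red h ≠ 0`): the `p`-power content of the product is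
that of `g`. [cite: Washington1997, §7.1] -/
theorem pfree_mul_of_red_ne_zero {p : ℕ} [Fact p.Prime] {g h : IwasawaAlgebra p} (hg : g ≠ 0) (hh : red h ≠ 0) :
    pfree (g * h) = pfree g * h := by
  have hred : red (pfree g * h) ≠ 0 := by
    rw [red_mul']
    exact mul_ne_zero (red_pfree_ne_zero hg) hh
  have hfac : g * h = PowerSeries.C ((p : ℤ_[p]) ^ mu g) * (pfree g * h) := by
    conv_lhs => rw [eq_C_pow_mu_mul_pfree g]
    ring
  exact (mu_eq_and_pfree_eq hred hfac).2

end Product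

/-! ## §3. (★-core) ⇒ (★) -/

section Glue

/-- The prime divisors of the conductor of a curve good at `2` are exactly the members of `S ∖ {2}` dividing it, when
`S ⊇ {ℓ prime : ℓ ∣ N}` consists of primes: `N.primeFactors = (S.filter (· ≠ 2)).filter (ord_·(N) ≠ 0)`. [folklore] -/
theorem primeFactors_conductorNorm_eq_filter (W : WeierstrassCurve ℚ) [W.IsElliptic] [W.IsGloballyMinimal]
    (hord : IsOrdinaryAt W 2) (S : Finset ℕ)
    (hSN : ∀ ℓ : ℕ, Nat.Prime ℓ → ℓ ∣ W.conductorNorm ℤ → ℓ ∈ S) :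
    (W.conductorNorm ℤ).primeFactors =
      (S.filter (· ≠ 2)).filter (fun ℓ ↦ (W.conductorNorm ℤ).factorization ℓ ≠ 0) := by
  have h2N : ¬ 2 ∣ W.conductorNorm ℤ := not_dvd_conductorNorm_of_hasGoodReductionAtPrime W hord.1
  ext ℓ
  rw [← Nat.support_factorization, Finsupp.mem_support_iff, Finset.mem_filter, Finset.mem_filter]
  constructor
  · intro hne
    have hmem : ℓ ∈ (W.conductorNorm ℤ).primeFactors := by
      rw [← Nat.support_factorization, Finsupp.mem_support_iff]; exact hne
    obtain ⟨hℓ, hdvd, -⟩ := Nat.mem_primeFactors.mp hmem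
    exact ⟨⟨hSN ℓ hℓ hdvd, fun h ↦ h2N (h ▸ hdvd)⟩, hne⟩
  · rintro ⟨-, hne⟩
    exact hne

/-- **(★-core) ⇒ (★).** The research stub (★) `StarCongruenceAtTwo` of line `star` (skeleton
`Cruxes/DepletedLambdaLawAtTwoMod/Lines/star.lean`, local definitions `curveEulerFactorAtTwo`, `frobeniusMinusOne`
unfolded) follows from its depletion-free core (★-core): for `W/ℚ` globally minimal, good ordinary at `2`, with a unique
rational `2`-torsion point of Greenberg type A or B, a newform `f` of `W`, nonzero `L₀ ∈ Λ` with `ι L₀ = c·L₂(f, α_W)`,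
and nonzero integral multiples `G₀`, `G₀^ι` of the Kubota–Leopoldt numerator `klTwoNumerator` and its involute,
`T²·red(pfree L₀) = red((1+T)^e)·red(pfree G₀)·red(pfree G₀^ι)·∏_{ℓ ∣ N_W} red(γ_ℓ − 1)^{m_ℓ}` for some `e ∈ ℤ₂`,
`m_ℓ = 1` if `ord_ℓ(N_W) = 1` and `2` otherwise. Multiplying by `red(∏_{ℓ∈S}𝒫_ℓ) = ∏_{ℓ∈S∖2} red(γ_ℓ − 1)^{d_ℓ}`
(`red_prod_depletingFactor_two_of_hasRationalTwoTorsionX`; `pfree(L₀·∏𝒫_ℓ) = pfree(L₀)·∏𝒫_ℓ`) and using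
`m_ℓ + d_ℓ = 2` at the primes of `N_W ⊆ S ∖ {2}`, `d_ℓ = 2` at the other odd primes of `S`, gives (★) with the same `e`.
[cite: GreenbergVatsal2000, §1 p. 9 (display (9)), §2 Prop. (2.4) (p. 22), §3 Thm. (3.12)] -/
theorem starCongruence_of_starCore
    (hcore : ∀ (W : WeierstrassCurve ℚ) [W.IsElliptic] [W.IsGloballyMinimal] (x : ℚ), IsOrdinaryAt W 2 →
      HasUniqueRationalTwoTorsionX W x →
      ((TwoTorsionRamifiedAtTwo x ∧ ¬ TwoTorsionOdd W x) ∨ (TwoTorsionOdd W x ∧ ¬ TwoTorsionRamifiedAtTwo x)) →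
      ∀ ⦃N : ℕ⦄ [NeZero N] (f : CuspForm (CongruenceSubgroup.Gamma0 N) 2), IsNewformOf W f →
      ∀ (c : ℚ) (L₀ : IwasawaAlgebra 2), L₀ ≠ 0 →
        iwasawaToPowerSeries 2 L₀ = PowerSeries.C (c : ℚ_[2]) * padicLFunction f (unitRoot W 2 : ℚ_[2]) →
      ∀ (cg : ℚ_[2]) (G₀ : IwasawaAlgebra 2), G₀ ≠ 0 →
        iwasawaToPowerSeries 2 G₀ = PowerSeries.C cg * klTwoNumerator →
      ∀ (ci : ℚ_[2]) (GI₀ : IwasawaAlgebra 2), GI₀ ≠ 0 →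
        iwasawaToPowerSeries 2 GI₀ = PowerSeries.C ci * klTwoNumeratorInv →
        ∃ e : ℤ_[2],
          PowerSeries.X ^ 2 * red (pfree L₀) =
            red (PowerSeries.binomialSeries ℤ_[2] e) * red (pfree G₀) * red (pfree GI₀) *
              ∏ ℓ ∈ (W.conductorNorm ℤ).primeFactors, red (frobeniusSeries 2 ℓ - 1) ^
                (if (W.conductorNorm ℤ).factorization ℓ = 1 then 1 else 2)) :
    ∀ (W : WeierstrassCurve ℚ) [W.IsElliptic] [W.IsGloballyMinimal] (x : ℚ), IsOrdinaryAt W 2 →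
      HasUniqueRationalTwoTorsionX W x →
      ((TwoTorsionRamifiedAtTwo x ∧ ¬ TwoTorsionOdd W x) ∨ (TwoTorsionOdd W x ∧ ¬ TwoTorsionRamifiedAtTwo x)) →
      ∀ ⦃N : ℕ⦄ [NeZero N] (f : CuspForm (CongruenceSubgroup.Gamma0 N) 2), IsNewformOf W f →
      ∀ (c : ℚ) (L₀ : IwasawaAlgebra 2), L₀ ≠ 0 →
        iwasawaToPowerSeries 2 L₀ = PowerSeries.C (c : ℚ_[2]) * padicLFunction f (unitRoot W 2 : ℚ_[2]) →
      ∀ (cg : ℚ_[2]) (G₀ : IwasawaAlgebra 2), G₀ ≠ 0 →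
        iwasawaToPowerSeries 2 G₀ = PowerSeries.C cg * klTwoNumerator →
      ∀ (ci : ℚ_[2]) (GI₀ : IwasawaAlgebra 2), GI₀ ≠ 0 →
        iwasawaToPowerSeries 2 GI₀ = PowerSeries.C ci * klTwoNumeratorInv →
      ∀ (S : Finset ℕ), (∀ ℓ ∈ S, Nat.Prime ℓ) → (∀ ℓ : ℕ, Nat.Prime ℓ → ℓ ∣ W.conductorNorm ℤ → ℓ ∈ S) →
        ∃ e : ℤ_[2],
          PowerSeries.X ^ 2 * red (pfree (L₀ * ∏ ℓ ∈ S, (if h : Nat.Prime ℓ ∧ ℓ ≠ 2 then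
              eulerFactorElement W 2 ((primesEquiv (R := 𝓞 ℚ)).symm ⟨ℓ, h.1⟩) else 1))) =
            red (PowerSeries.binomialSeries ℤ_[2] e) * red (pfree G₀) * red (pfree GI₀) *
              ∏ ℓ ∈ S.filter (· ≠ 2), red (frobeniusSeries 2 ℓ - 1) ^ 2 := by
  intro W _ _ x hord hx hAB N _ f hf c L₀ hL₀ hι cg G₀ hG₀ hιG ci GI₀ hGI₀ hιGI S hS hSN
  obtain ⟨e, he⟩ := hcore W x hord hx hAB f hf c L₀ hL₀ hι cg G₀ hG₀ hιG ci GI₀ hGI₀ hιGI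
  refine ⟨e, ?_⟩
  obtain ⟨-, hPred⟩ := red_prod_depletingFactor_two_of_hasRationalTwoTorsionX W hx.1 S hS
  have hredP : red (∏ ℓ ∈ S, (if h : Nat.Prime ℓ ∧ ℓ ≠ 2 then
      eulerFactorElement W 2 ((primesEquiv (R := 𝓞 ℚ)).symm ⟨ℓ, h.1⟩) else 1)) ≠ 0 := by
    rw [hPred]
    exact Finset.prod_ne_zero_iff.mpr fun ℓ hℓ ↦ pow_ne_zero _
      (red_frobeniusSeries_sub_one_ne_zero_two (hS ℓ (Finset.mem_filter.mp hℓ).1) (Finset.mem_filter.mp hℓ).2)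
  rw [pfree_mul_of_red_ne_zero hL₀ hredP, red_mul', hPred, ← mul_assoc, he,
    primeFactors_conductorNorm_eq_filter W hord S hSN, Finset.prod_filter, mul_assoc, ← Finset.prod_mul_distrib]
  congr 1
  refine Finset.prod_congr rfl fun ℓ _ ↦ ?_
  rcases Nat.lt_or_ge ((W.conductorNorm ℤ).factorization ℓ) 2 with hlt | hge
  · rcases Nat.lt_or_ge ((W.conductorNorm ℤ).factorization ℓ) 1 with h0 | h1
    · have hf : (W.conductorNorm ℤ).factorization ℓ = 0 := by omega
      rw [if_neg (not_not.mpr hf), if_pos hf, one_mul]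
    · have hf : (W.conductorNorm ℤ).factorization ℓ = 1 := by omega
      rw [if_pos (by omega), if_pos hf, if_neg (by omega), if_pos hf, ← pow_add]
  · rw [if_pos (by omega), if_neg (by omega), if_neg (by omega), if_neg (by omega), ← pow_add]

end Glue

end Summit.BirchSwinnertonDyer.BirchSwinnertonDyer.Theorems.DepletionAtTwo

end
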